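import Literature.NumberTheory.EllipticCurves.ManinConstantAdditivePrimesProofs
import HarnessLib

/-!
# A cuspidal reduction has infinite height: `[p]˜ = 0` at EVERY additive prime, `p = 2, 3`
# included; the Honda witness is free there (proofs only)

Topic `NumberTheory/EllipticCurves` (theorems only; no definition, no named fact). The file
`AdditiveReductionSemistableModelProofs` proves `[p]˜ = 0` for the SHORT model of a curve with
additive reduction at a prime `p ≥ 5` (its reduction is literally `y² = x³`). Here the same is
proved for ANY Weierstrass equation `V/ℤ_p` whose reduction is cuspidal (`Δ̃ = 0`, `c̃₄ = 0`), at
every prime `p`: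

* `exists_variableChange_eq_zero_of_cuspidal` — over `𝔽_p` a cuspidal Weierstrass cubic is
  `𝔽_p`-isomorphic, by a change of variables with `u = 1`, to `y² = x³` (for `p ≥ 5` complete the
  square and the cube; for `p = 3`, `c₄ = b₂²` forces `b₂ = 0`, `Δ = −a₄³` forces `a₄ = 0`, and
  `a₆ = a₆³` is a cube; for `p = 2`, `c₄ = a₁⁴` and then `Δ = a₃⁴` force `a₁ = a₃ = 0`, and the cusp
  `(a₄, a₂a₄ + a₆)` of `y² = x³ + a₂x² + a₄x + a₆` — squares are free in `𝔽₂` — is moved to the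
  origin and the double tangent `y = (a₂ + a₄)x` straightened);
* `formalMul_prime_map_toZMod_eq_zero_of_cuspidal` — hence **`[p]˜_V = 0`**: lift the change of
  variables to `C₁ = (1, r, s, t)` over `ℤ_p`; `[p]` of `C₁ • V` vanishes mod `p`
  (`formalMul_eq_zero_of_a_eq_zero_of_charP`: `[n] = nX` on `y² = x³`), and the isomorphism
  `θ : V̂ ⥲ (C₁ • V)^` (`formalVariableChange`, `p`-integral, `θ = X + ⋯`) intertwines `[p]`
  (`[p]' ∘ θ = θ ∘ [p]`, equal logarithms), so `θ̃([p]˜_V) = 0` and `[p]˜_V = 0`;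
* for a globally minimal `W/ℚ` and a prime `p ∣ Δ_min(W)`, `p ∣ c₄(W)` (additive reduction,
  Silverman VII.5.1(c)), every `p`: `formalMul_prime_map_toZMod_eq_zero_of_dvd_of_dvd`
  (**infinite height**), `norm_coeff_formalLog_le_one_of_dvd_of_dvd` (**`log_W ∈ ℤ_p⟦X⟧`**, Honda
  type `p`: `FormalGroupInfiniteHeightProofs`), and
  `exists_padicInt_formalLog_subst_eq_lSeriesLog_of_dvd_of_dvd` (**the Honda witness
  `Σ aₙ(W)Xⁿ/n = log_W(ψ)`, `ψ ∈ Xℤ_p⟦X⟧`, is free**: `aₙ = 0` for `p ∣ n`).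

So at an additive prime `p ∈ {2, 3}` — the only primes left open for the integrality of the Manin
constant along the finite-height route (`NeronIsogenyScaling.lean`, fact
`edixhoven_int_of_neronLattice_eq_smul_periodLattice`; `ManinConstantFiniteHeightPrimesProofs`) —
input (ii) (Honda) is available for the minimal model itself, exactly as for `p ≥ 5`; what remains
is input (i), finite height, on a semistable model over an extension of `ℤ_p`.

## References

* J. H. Silverman, *The Arithmetic of Elliptic Curves*, 2nd ed. (2009), III.1 (changes of
  variables), Prop. III.2.5 (`E_ns ≅ 𝔾_a` for a cusp), IV.1–IV.2, VII.5 Prop. 5.1(c), App. A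
  Prop. 1.1–1.2 (normal forms in characteristics `2` and `3`). [SilvermanAEC2009]
* T. Honda, *On the theory of commutative formal groups*, J. Math. Soc. Japan 22 (1970), Thm. 2
  (p. 223: a group with `[p] ≡ 0` is of type `p`). [Honda1970]
-/

noncomputable section

open scoped Classical

namespace WeierstrassCurve

open PowerSeries Literature.NumberTheory.EllipticCurves Literature.RingTheory.FormalGroups

/-! ### Over `𝔽_p`: a cuspidal cubic is `y² = x³` up to a change of variables with `u = 1` -/

section RST

variable {R : Type*} [CommRing R] (W : WeierstrassCurve R)

/-- The change of variables `(1, r, s, t)` on the coefficients (Silverman III.1, Table 3.1 with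
`u = 1`). [cite: SilvermanAEC2009, III.1 Table 3.1] -/
theorem one_rst_smul (r s t : R) :
    (⟨1, r, s, t⟩ : VariableChange R) • W =
      { a₁ := W.a₁ + 2 * s, a₂ := W.a₂ - s * W.a₁ + 3 * r - s ^ 2, a₃ := W.a₃ + r * W.a₁ + 2 * t,
        a₄ := W.a₄ - s * W.a₃ + 2 * r * W.a₂ - (t + r * s) * W.a₁ + 3 * r ^ 2 - 2 * s * t,
        a₆ := W.a₆ + r * W.a₄ + r ^ 2 * W.a₂ + r ^ 3 - t * W.a₃ - t ^ 2 - r * t * W.a₁ } := by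
  ext <;> simp [variableChange_a₁, variableChange_a₂, variableChange_a₃, variableChange_a₄,
    variableChange_a₆]

end RST

section Field

variable {p : ℕ} [hp : Fact p.Prime] (E : WeierstrassCurve (ZMod p))

/-- `Δ = a₃⁴` in characteristic `2` when `a₁ = 0`. [cite: SilvermanAEC2009, App. A Prop. 1.1] -/
theorem Δ_eq_a₃_pow_four_of_two (h2 : (2 : ZMod p) = 0) (h₁ : E.a₁ = 0) : E.Δ = E.a₃ ^ 4 := by
  rw [Δ, b₂, b₄, b₆, b₈, h₁]
  linear_combination (-8 * E.a₂ ^ 2 * (4 * E.a₂ * E.a₆ + E.a₂ * E.a₃ ^ 2 - E.a₄ ^ 2) - 32 * E.a₄ ^ 3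
    - 14 * E.a₃ ^ 4 - 108 * E.a₃ ^ 2 * E.a₆ - 216 * E.a₆ ^ 2
    + 36 * E.a₂ * E.a₄ * (E.a₃ ^ 2 + 4 * E.a₆)) * h2

/-- `c₄ = b₂²` in characteristic `3`. [cite: SilvermanAEC2009, App. A Prop. 1.2] -/
theorem c₄_eq_b₂_sq_of_three (h3 : (3 : ZMod p) = 0) : E.c₄ = E.b₂ ^ 2 := by
  rw [c₄]
  linear_combination (-8 * E.b₄) * h3

/-- **A cuspidal Weierstrass cubic over `𝔽_p` is `y² = x³` up to an `𝔽_p`-change of variables with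
`u = 1`**, every prime `p` (`Δ = 0`, `c₄ = 0`: the singular point is a cusp; Silverman III.1,
App. A). [cite: SilvermanAEC2009, Prop. III.2.5 and App. A Prop. 1.1–1.2] -/
theorem exists_variableChange_eq_zero_of_cuspidal (hc₄ : E.c₄ = 0) (hΔ : E.Δ = 0) :
    ∃ C : VariableChange (ZMod p), C.u = 1 ∧
      C • E = ({ a₁ := 0, a₂ := 0, a₃ := 0, a₄ := 0, a₆ := 0 } : WeierstrassCurve (ZMod p)) := by
  have hpow : ∀ x : ZMod p, x ^ p = x := ZMod.pow_card
  by_cases hp2 : p = 2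
  · -- characteristic 2: `a₁ = a₃ = 0`, cusp at `(a₄, a₂a₄ + a₆)`, double tangent `y = (a₂ + a₄)x`
    subst hp2
    have h2 : (2 : ZMod 2) = 0 := rfl
    have h₁ : E.a₁ = 0 := pow_eq_zero_iff (n := 4) (by norm_num) |>.mp
      ((c₄_eq_a₁_pow_four h2 E).symm.trans hc₄)
    have h₃ : E.a₃ = 0 := pow_eq_zero_iff (n := 4) (by norm_num) |>.mp
      ((E.Δ_eq_a₃_pow_four_of_two h2 h₁).symm.trans hΔ)
    have hsq : ∀ x : ZMod 2, x ^ 2 = x := hpow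
    refine ⟨⟨1, E.a₄, E.a₂ + E.a₄, E.a₂ * E.a₄ + E.a₆⟩, rfl, ?_⟩
    rw [one_rst_smul]
    refine WeierstrassCurve.ext ?_ ?_ ?_ ?_ ?_ <;> dsimp only
    · linear_combination h₁ + (E.a₂ + E.a₄) * h2
    · linear_combination (-(E.a₂ + E.a₄)) * h₁ + E.a₄ * h2 - hsq (E.a₂ + E.a₄)
    · linear_combination h₃ + E.a₄ * h₁ + (E.a₂ * E.a₄ + E.a₆) * h2
    · linear_combination (2 * E.a₄ + E.a₄ * E.a₂ - (E.a₂ + E.a₄) * (E.a₂ * E.a₄ + E.a₆)) * h2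
        + 3 * hsq E.a₄ - (E.a₂ + E.a₄) * h₃
        - ((E.a₂ * E.a₄ + E.a₆) + E.a₄ * (E.a₂ + E.a₄)) * h₁
    · linear_combination E.a₄ * h2 + (2 + E.a₂ + E.a₄) * hsq E.a₄ - hsq (E.a₂ * E.a₄ + E.a₆)
        - (E.a₂ * E.a₄ + E.a₆) * h₃ - E.a₄ * (E.a₂ * E.a₄ + E.a₆) * h₁
  by_cases hp3 : p = 3
  · -- characteristic 3: `b₂ = 0`, short form `y² = x³ + a₄x + a₆`, `a₄ = 0`, `a₆ = (a₆)³`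
    subst hp3
    have h3 : (3 : ZMod 3) = 0 := rfl
    have hb₂ : E.b₂ = 0 := pow_eq_zero_iff (n := 2) (by norm_num) |>.mp
      ((E.c₄_eq_b₂_sq_of_three h3).symm.trans hc₄)
    set C₃ := E.toShortNFOfCharThree with hC₃
    set E' := C₃ • E with hE'
    haveI hsh : E'.IsShortNF := E.toShortNFOfCharThree_spec hb₂
    have hC₃u : C₃.u = 1 := rfl
    have hΔ' : E'.Δ = 0 := by
      rw [hE', variableChange_Δ, hC₃u, inv_one, Units.val_one, one_pow, one_mul, hΔ]
    have h₄ : E'.a₄ = 0 := by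
      have h : E'.a₄ ^ 3 = 0 := by
        have e := E'.Δ_of_isShortNF
        rw [hΔ'] at e
        linear_combination e + (-21 * E'.a₄ ^ 3 - 144 * E'.a₆ ^ 2) * h3
      exact pow_eq_zero_iff (n := 3) (by norm_num) |>.mp h
    refine ⟨⟨1, -E'.a₆, 0, 0⟩ * C₃, by rw [VariableChange.mul_def]; simp [hC₃u], ?_⟩
    rw [mul_smul, ← hE', one_rst_smul]
    refine WeierstrassCurve.ext ?_ ?_ ?_ ?_ ?_ <;> dsimp only
    · rw [E'.a₁_of_isShortNF]; ring
    · rw [E'.a₁_of_isShortNF, E'.a₂_of_isShortNF]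
      linear_combination (-E'.a₆) * h3
    · rw [E'.a₁_of_isShortNF, E'.a₃_of_isShortNF]; ring
    · rw [E'.a₁_of_isShortNF, E'.a₂_of_isShortNF, E'.a₃_of_isShortNF, h₄]
      linear_combination (E'.a₆ ^ 2) * h3
    · rw [E'.a₁_of_isShortNF, E'.a₂_of_isShortNF, E'.a₃_of_isShortNF, h₄]
      linear_combination -(hpow E'.a₆)
  -- `p ≥ 5`: `2, 3` are invertible, short form `y² = x³ + Ax + B` with `48A = 0`, `432B² = 0`
  have hne : ∀ n : ℕ, 0 < n → n < p → (n : ZMod p) ≠ 0 := fun n hn hnp h ↦ by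
    rw [ZMod.natCast_eq_zero_iff] at h
    exact absurd (Nat.le_of_dvd hn h) (not_le.mpr hnp)
  have hp5 : 5 ≤ p := by
    have h2 := hp.out.two_le
    rcases Nat.lt_or_ge p 5 with h | h
    · interval_cases p
      · exact absurd rfl hp2
      · exact absurd rfl hp3
      · exact absurd hp.out (by decide)
    · exact h
  have h2 : (2 : ZMod p) ≠ 0 := by exact_mod_cast hne 2 (by norm_num) (by omega)
  have h3 : (3 : ZMod p) ≠ 0 := by exact_mod_cast hne 3 (by norm_num) (by omega)
  letI : Invertible (2 : ZMod p) := invertibleOfNonzero h2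
  letI : Invertible (3 : ZMod p) := invertibleOfNonzero h3
  set C₅ := E.toShortNF with hC₅
  set E' := C₅ • E with hE'
  haveI hsh : E'.IsShortNF := E.toShortNF_spec
  have hC₅u : C₅.u = 1 := by
    rw [hC₅, toShortNF, VariableChange.mul_def]
    simp [toCharNeTwoNF]
  have h48 : (48 : ZMod p) ≠ 0 := by
    have : (48 : ZMod p) = 2 ^ 4 * 3 := by norm_num
    rw [this]
    exact mul_ne_zero (pow_ne_zero 4 h2) h3
  have h432 : (432 : ZMod p) ≠ 0 := by
    have : (432 : ZMod p) = 2 ^ 4 * 3 ^ 3 := by norm_num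
    rw [this]
    exact mul_ne_zero (pow_ne_zero 4 h2) (pow_ne_zero 3 h3)
  have h₄ : E'.a₄ = 0 := by
    have e := E'.c₄_of_isShortNF
    rw [hE', variableChange_c₄, hC₅u, inv_one, Units.val_one, one_pow, one_mul, hc₄] at e
    have : (48 : ZMod p) * (C₅ • E).a₄ = 0 := by linear_combination e
    exact (mul_eq_zero.mp this).resolve_left h48
  have h₆ : E'.a₆ = 0 := by
    have e := E'.Δ_of_isShortNF
    rw [h₄, hE', variableChange_Δ, hC₅u, inv_one, Units.val_one, one_pow, one_mul, hΔ] at e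
    have : (432 : ZMod p) * (C₅ • E).a₆ ^ 2 = 0 := by linear_combination e
    exact pow_eq_zero_iff (n := 2) (by norm_num) |>.mp ((mul_eq_zero.mp this).resolve_left h432)
  refine ⟨C₅, hC₅u, ?_⟩
  rw [← hE']
  exact WeierstrassCurve.ext E'.a₁_of_isShortNF E'.a₂_of_isShortNF E'.a₃_of_isShortNF h₄ h₆

end Field

/-! ### Over `ℤ_p`: `[p]˜ = 0` for a cuspidal reduction -/

section Padic

variable {p : ℕ} [hp : Fact p.Prime] (V : WeierstrassCurve ℤ_[p])

/-- **`[p]' ∘ θ = θ ∘ [p]` for the isomorphism `θ : V̂ ⥲ (C • V)^` of a change of variables with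
`u = 1` over `ℤ_p`** (equal logarithms over `ℚ_p`: `log'(θ) = log`, `log'([n]'·) = n log'`,
`log([n]·) = n log`). [cite: SilvermanAEC2009, IV.2 and IV.5] -/
theorem formalMul_variableChange_subst_formalVariableChange (C₁ : VariableChange ℤ_[p]) (hu : C₁.u = 1)
    (n : ℕ) :
    (((C₁ • V).map PadicInt.Coe.ringHom).formalMul n).subst
        ((V.map PadicInt.Coe.ringHom).formalVariableChange (C₁.map PadicInt.Coe.ringHom)) =
      ((V.map PadicInt.Coe.ringHom).formalVariableChange (C₁.map PadicInt.Coe.ringHom)).subst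
        ((V.map PadicInt.Coe.ringHom).formalMul n) := by
  set W₁ := V.map PadicInt.Coe.ringHom with hW₁
  set C' := C₁.map PadicInt.Coe.ringHom with hC'
  set W₂ := (C₁ • V).map PadicInt.Coe.ringHom with hW₂
  set θ := W₁.formalVariableChange C' with hθ
  haveI : W₁.IsIntegral ℤ_[p] := V.isIntegral_map_coe
  haveI : W₂.IsIntegral ℤ_[p] := (C₁ • V).isIntegral_map_coe
  have hW₂' : W₂ = C' • W₁ := by rw [hW₂, hC', hW₁, map_variableChange]
  have hC'u : (C'.u : ℚ_[p]) = 1 := by simp [hC', VariableChange.map, hu]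
  have hθ0 : constantCoeff θ = 0 := W₁.constantCoeff_formalVariableChange C'
  have hθs : HasSubst θ := HasSubst.of_constantCoeff_zero' hθ0
  have hns : HasSubst (W₁.formalMul n) := W₁.hasSubst_formalMul n
  have hlogθ : W₂.formalLog.subst θ = W₁.formalLog := by
    rw [hW₂', hθ, W₁.formalLog_variableChange_subst C', hC'u, map_one, one_mul]
  have hL0 : constantCoeff ((W₂.formalMul n).subst θ) = 0 :=
    (constantCoeff_subst_eq_constantCoeff hθ0).trans (W₂.constantCoeff_formalMul n)
  have hR0 : constantCoeff (θ.subst (W₁.formalMul n)) = 0 :=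
    (constantCoeff_subst_eq_constantCoeff (W₁.constantCoeff_formalMul n)).trans hθ0
  refine W₂.eq_of_formalLog_subst_eq hL0 hR0 ?_
  rw [← subst_comp_subst_apply (W₂.hasSubst_formalMul n) hθs, W₂.formalLog_subst_formalMul n,
    ← coe_substAlgHom hθs, map_nsmul, coe_substAlgHom, hlogθ,
    ← subst_comp_subst_apply hθs hns, hlogθ, W₁.formalLog_subst_formalMul n]

/-- **A cuspidal reduction has infinite height: `[p]˜ = 0`**, every prime `p`. For `V/ℤ_p` with
`Δ̃ = 0`, `c̃₄ = 0` the multiplication by `p` of the reduction `Ṽ = V ⊗ 𝔽_p` is the zero series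
(`Ṽ` is a cuspidal cubic, `Ê_ns ≅ 𝔾̂_a`: Silverman III.2.5). Proof: `C • Ṽ = (y² = x³)` for an
`𝔽_p`-change of variables `C = (1, r, s, t)` (`exists_variableChange_eq_zero_of_cuspidal`), lifted
to `C₁` over `ℤ_p`; `[p]` of `C₁ • V` vanishes mod `p` (`[n] = nX` on `y² = x³`); and
`[p]' ∘ θ = θ ∘ [p]` for the `p`-integral isomorphism `θ = X + ⋯` gives `θ̃([p]˜) = 0`, so
`[p]˜ = 0`. [cite: SilvermanAEC2009, Prop. III.2.5] [cite: Honda1970, Thm. 2 (p. 223)] -/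
theorem formalMul_prime_map_toZMod_eq_zero_of_cuspidal (hc₄ : (V.map PadicInt.toZMod).c₄ = 0)
    (hΔ : (V.map PadicInt.toZMod).Δ = 0) : (V.map PadicInt.toZMod).formalMul p = 0 := by
  obtain ⟨C, hCu, hCE⟩ := (V.map PadicInt.toZMod).exists_variableChange_eq_zero_of_cuspidal hc₄ hΔ
  -- lift `C = (1, r, s, t)` to `ℤ_p`
  obtain ⟨r₁, hr₁⟩ := ZMod.ringHom_surjective (PadicInt.toZMod (p := p)) C.r
  obtain ⟨s₁, hs₁⟩ := ZMod.ringHom_surjective (PadicInt.toZMod (p := p)) C.s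
  obtain ⟨t₁, ht₁⟩ := ZMod.ringHom_surjective (PadicInt.toZMod (p := p)) C.t
  set C₁ : VariableChange ℤ_[p] := ⟨1, r₁, s₁, t₁⟩ with hC₁
  have hC₁C : C₁.map PadicInt.toZMod = C := by
    refine VariableChange.ext (Units.ext ?_) hr₁ hs₁ ht₁
    simp [hC₁, hCu]
  -- `[p]` of `C₁ • V` vanishes mod `p`
  have hzero : ((C₁ • V).map PadicInt.toZMod).formalMul p = 0 := by
    rw [← map_variableChange, hC₁C, hCE]
    exact formalMul_eq_zero_of_a_eq_zero_of_charP _ p rfl rfl rfl rfl rfl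
  -- the intertwining over `ℚ_p`, pulled back to `ℤ_p`
  set W₁ := V.map PadicInt.Coe.ringHom with hW₁
  set C' := C₁.map PadicInt.Coe.ringHom with hC'
  set θ := W₁.formalVariableChange C' with hθ
  haveI : W₁.IsIntegral ℤ_[p] := V.isIntegral_map_coe
  have hθ0 : constantCoeff θ = 0 := W₁.constantCoeff_formalVariableChange C'
  have hθ1 : coeff 1 θ = 1 := by
    rw [hθ, coeff_one_formalVariableChange]
    simp [hC', VariableChange.map, hC₁]
  have hθi : IsPadicInt θ := by
    refine W₁.isPadicInt_formalVariableChange C' ?_ ?_ ?_ ?_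
    · simp [hC', VariableChange.map, hC₁]
    · simpa [hC', VariableChange.map, hC₁] using PadicInt.norm_le_one r₁
    · simpa [hC', VariableChange.map, hC₁] using PadicInt.norm_le_one s₁
    · simpa [hC', VariableChange.map, hC₁] using PadicInt.norm_le_one t₁
  obtain ⟨θ₁, hθ₁⟩ := isPadicInt_iff_exists_powerSeries_map.mp hθi
  have hθ₁0 : constantCoeff θ₁ = 0 := by
    have h := hθ0
    rw [← hθ₁, ← coeff_zero_eq_constantCoeff, coeff_map, coeff_zero_eq_constantCoeff] at h
    exact PadicInt.coe_eq_zero.mp h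
  have hθ₁1 : coeff 1 θ₁ = 1 := by
    have h := hθ1
    rw [← hθ₁, coeff_map] at h
    exact PadicInt.ext h
  have hθ₁s : HasSubst θ₁ := HasSubst.of_constantCoeff_zero' hθ₁0
  have key : ((C₁ • V).formalMul p).subst θ₁ = θ₁.subst (V.formalMul p) := by
    apply PowerSeries.map_injective (PadicInt.Coe.ringHom (p := p)) (fun _ _ h ↦ PadicInt.ext h)
    rw [powerSeries_map_subst PadicInt.Coe.ringHom hθ₁s,
      powerSeries_map_subst PadicInt.Coe.ringHom (V.hasSubst_formalMul p), map_formalMul, map_formalMul, hθ₁]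
    exact V.formalMul_variableChange_subst_formalVariableChange C₁ rfl p
  -- reduce mod `p`: `0 = θ̃([p]˜)`
  have hθt0 : constantCoeff (PowerSeries.map PadicInt.toZMod θ₁) = 0 := by
    rw [← coeff_zero_eq_constantCoeff, coeff_map, coeff_zero_eq_constantCoeff, hθ₁0, map_zero]
  have hθts : HasSubst (PowerSeries.map PadicInt.toZMod θ₁) := HasSubst.of_constantCoeff_zero' hθt0
  have hθtne : PowerSeries.map PadicInt.toZMod θ₁ ≠ 0 := by
    intro h
    have h1 := congrArg (coeff 1) h
    rw [coeff_map, hθ₁1, map_one, map_zero] at h1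
    exact one_ne_zero h1
  have hred := congrArg (PowerSeries.map PadicInt.toZMod) key
  rw [powerSeries_map_subst PadicInt.toZMod hθ₁s, powerSeries_map_subst PadicInt.toZMod (V.hasSubst_formalMul p),
    map_formalMul, map_formalMul, hzero, zero_subst_eq_zero hθts] at hred
  by_contra hne
  exact subst_ne_zero_of_ne_zero hθtne ((V.map PadicInt.toZMod).constantCoeff_formalMul p) hne hred.symm

end Padic

/-! ### A globally minimal curve at an additive prime, every `p` -/

section Additive

variable {p : ℕ} [hp : Fact p.Prime] (W : WeierstrassCurve ℚ) [W.IsElliptic] [W.IsGloballyMinimal]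

omit [W.IsElliptic] in
/-- **Infinite height at every additive prime**: for a globally minimal `W/ℚ` and a prime
`p ∣ Δ_min(W)`, `p ∣ c₄(W)` (additive reduction, Silverman VII.5.1(c)), `[p]˜ = 0` for the
reduction of the minimal model — every `p`, `2` and `3` included.
[cite: SilvermanAEC2009, VII.5 Prop. 5.1(c) and Prop. III.2.5] -/
theorem formalMul_prime_map_toZMod_eq_zero_of_dvd_of_dvd (hΔ : (p : ℤ) ∣ minimalDiscriminantInt W)
    (hc₄ : (p : ℤ) ∣ (integralModelInt W).c₄) :
    ((integralModelInt W).map (Int.castRingHom (ZMod p))).formalMul p = 0 := by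
  have h := ((integralModelInt W).map (Int.castRingHom ℤ_[p])).formalMul_prime_map_toZMod_eq_zero_of_cuspidal
    ?_ ?_
  · rwa [map_toZMod_integralModelInt] at h
  · rw [map_toZMod_integralModelInt, map_c₄, eq_intCast, ZMod.intCast_zmod_eq_zero_iff_dvd]
    exact hc₄
  · rw [map_toZMod_integralModelInt, map_Δ, eq_intCast, ZMod.intCast_zmod_eq_zero_iff_dvd]
    exact hΔ

omit [W.IsElliptic] in
/-- **`log_W ∈ ℤ_p⟦X⟧` at every additive prime** (Honda type `p`): the formal logarithm of
`W ⊗ ℚ_p` has `p`-integral coefficients. [cite: Honda1970, Thm. 2 (p. 223)]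
[cite: SilvermanAEC2009, VII.5 Prop. 5.1(c)] -/
theorem norm_coeff_formalLog_le_one_of_dvd_of_dvd (hΔ : (p : ℤ) ∣ minimalDiscriminantInt W)
    (hc₄ : (p : ℤ) ∣ (integralModelInt W).c₄) (n : ℕ) :
    ‖coeff n (W.map (algebraMap ℚ ℚ_[p])).formalLog‖ ≤ 1 := by
  have h := ((integralModelInt W).map (Int.castRingHom ℤ_[p])).norm_coeff_formalLog_le_one_of_formalMul_prime_eq_zero
    (by rw [map_toZMod_integralModelInt]; exact W.formalMul_prime_map_toZMod_eq_zero_of_dvd_of_dvd hΔ hc₄) n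
  rwa [map_coe_integralModelInt] at h

/-- **The Honda witness is free at every additive prime**: for a globally minimal elliptic `W/ℚ`
and a prime `p ∣ Δ_min(W)`, `p ∣ c₄(W)` there is `ψ ∈ Xℚ_p⟦X⟧` with `p`-integral coefficients and
`log_{W ⊗ ℚ_p}(ψ) = Σₙ aₙ(W) Xⁿ/n` — every `p` (`ψ = exp_W(ℓ)`: `exp_W ∈ ℤ_p⟦X⟧` at infinite
height, `aₙ = 0` for `p ∣ n`). [cite: Honda1970, Thm. 2 (p. 223)]
[cite: SilvermanAEC2009, §C.16 (definition of L_v(T)), PDF p. 390] -/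
theorem exists_padicInt_formalLog_subst_eq_lSeriesLog_of_dvd_of_dvd
    (hΔ : (p : ℤ) ∣ minimalDiscriminantInt W) (hc₄ : (p : ℤ) ∣ (integralModelInt W).c₄) :
    ∃ ψ : ℚ_[p]⟦X⟧, constantCoeff ψ = 0 ∧ (∀ n, ‖coeff n ψ‖ ≤ 1) ∧
      (W.map (algebraMap ℚ ℚ_[p])).formalLog.subst ψ =
        PowerSeries.mk fun k ↦ ((W.LFunction k : ℤ) : ℚ_[p]) / k := by
  have h0 : (((integralModelInt W).map (Int.castRingHom ℤ_[p])).map PadicInt.toZMod).formalMul p = 0 := by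
    rw [map_toZMod_integralModelInt]; exact W.formalMul_prime_map_toZMod_eq_zero_of_dvd_of_dvd hΔ hc₄
  have hℓ0 : constantCoeff (PowerSeries.mk fun k ↦ ((W.LFunction k : ℤ) : ℚ_[p]) / k) = 0 := by
    rw [← coeff_zero_eq_constantCoeff_apply, coeff_mk, Nat.cast_zero, div_zero]
  obtain ⟨ψ, hψ0, hψi, hψ⟩ :=
    ((integralModelInt W).map (Int.castRingHom ℤ_[p])).exists_padicInt_formalLog_subst_eq_of_formalMul_prime_eq_zero
      h0 hℓ0 (W.norm_coeff_lSeriesLog_le_one_of_dvd_of_dvd p hΔ hc₄)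
  refine ⟨ψ, hψ0, hψi, ?_⟩
  rwa [map_coe_integralModelInt] at hψ

end Additive

end WeierstrassCurve
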